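/-
Copyright (c) 2026 the pub-hodgecm-mathlib formalisation cell (harness21).  Prover seat hodgecm-mathlib-K2E3-p31 (g2) on LEAD F0P6-plan (g15) BATCH #183 (3) RULING
«M-160c» (iii)(a) ∕ #184 (a) ∕ #185 (F4 desk K2Liu-p27 (g3) per BATCH #188), Track B «K2-LIT» ∕ hLiu418 #184♮ = `stmt-HodgeConjecture-24832`, Road I v3 U5 «THE CLOSE» —
FACE-G ∕ F4 ∕ #42F′ AT THE SIGN-FRAME-ADAPTED ARCH CLASS: the reference datum `𝒦₁` and the standing closure letter `hK₀` on its arch class.  THEOREMS ONLY (no `def`,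
no `instance`, no notation, no named-fact hypothesis, no `sorry`); lane `--supports stmt-HodgeConjecture-24832 --as helper`.
-/
import Summits.HodgeConjecture.HodgeConjecture.Theorems.K2LiuStdConjDatumFrameCompact     -- ★ (R1) `exists_conjDatum_frameCompact` (a conjugate datum of FRAME-COMPACT type; ★ B2∕B3)
import Summits.HodgeConjecture.HodgeConjecture.Theorems.K2LiuIwasawaDatumConjStd          -- ★ (T) `isStd_of_conj` (a conjugate of a standard datum is standard)
import Summits.HodgeConjecture.HodgeConjecture.Theorems.K2LiuIwasawaDatumNonemptyStd      -- ★ J2 `iwasawaDatumNonempty_std` (a standard datum exists: the tree's `K₉`)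
import HarnessLib

/-!
# Crux `HLiu418`, FACE-G ∕ F4 ∕ #42F′ (RULING «M-160c»): THE SIGN-FRAME-ADAPTED STANDARD IWASAWA DATUM `𝒦₁` AND THE CLOSURE LETTER `hK₀` ON ITS ARCH CLASS

Cell `hodgecm-mathlib`, crux item hLiu418 = `stmt-HodgeConjecture-24832`; squad K2 ∕ K2Liu (L1 LEAD F0P6-plan (g15), F4 desk K2Liu-p27 (g3)); prover K2E3-p31 (g2).
THEOREMS ONLY; lane `--supports stmt-HodgeConjecture-24832 --as helper` (count-neutral; closes no socket by itself).

WHY (census memo `CENSUS-hK.K2E3-p31-g2.md` 60b31c8f62deea41, adopted by RULING «M-160c» (i)–(iii)).  Every CONSTRUCTED F4 stability ∕ closure letter of the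
close — `hdat` of ★ `K2LiuArchSWDataDomainLetters` ((dom)+(vac)), hence the bare closure letter
`hK₀(𝒦) : ∀ a_∞, (a_∞, 1_f) ∈ 𝒦.K → a_∞ ∈ Submonoid.closure {placeSec_𝔻 σ (kV k₁) | σ real, k₁ ∈ U(P_σ) × U(Q_σ)}` of ★ `K2LiuArchPlaceSecFockDegree.
isArchDatum_hermiteSpan_of_closure_kV` (the ★ bridge `hK₀ ⇒ hK` to ★ σ15) — is owed ONLY for standard data in the ARCH CLASS of ONE sign-frame-adapted reference
datum `𝒦₁` (`IsStd ⇏ hK₀`: a standard datum's archimedean compact is an arbitrary CONJUGATE `g K_diag g⁻¹` of the sign-frame compact `K_diag`, ★ B2∕B3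
`K2LiuSignBlockCompactPlaceSec.exists_conj_archCompact_closure`); the general standard datum is reached by the ONE transport head (T-F′)
`K2LiuRigidityFaceArchClassTransport.faceR_of_faceR_archClass` (R90-C10-p03 (g0)).  THIS FILE supplies the reference and the letter:
* §1 **`exists_isStd_signFrameAdapted`** — there IS a STANDARD Iwasawa datum `𝒦₁` whose archimedean part is EXACTLY the sign-frame compact:
  `(a, 1_f) ∈ 𝒦₁.K ↔ a ∈ Submonoid.closure {placeSec_𝔻 σ (kV k₁)}`.  It is NOT the datum of record `K₉` itself (★ `K2LiuIwasawaDatumOfRecordFrame`: `K₉`'s frame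
  `S = [[1, X],[1, −X]]`, `X = ½T⁻¹w`, is the Cayley–Witt frame — `Sᵀ·diag(T, −T)·S = [[0, w],[w, 0]]` — whose archimedean compact stabilises the majorant `(SS^*)⁻¹`
  with off-diagonal block `1 − ¼T⁻¹T⁻*`, sign-block-diagonal only when `T_σ² = ¼`; ★ p862973 `exists_isStd_leviAdapted(_arch)` inherits that frame), but the CONJUGATE
  of `K₉` of FRAME-COMPACT type delivered by ★ (R1) `K2LiuStdConjDatumFrameCompact.exists_conjDatum_frameCompact` (over ★ B2∕B3), which is again STANDARD by ★ (T)
  `K2LiuIwasawaDatumConjStd.isStd_of_conj` (`C_∞′ = g⁻¹C_∞g`, `C_f′ = C_f`, frame `g_∞⁻¹S`).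
* §2 **`hK₀_of_signFrameAdapted`** (`hK₀(𝒦₁)`), **`hK₀_of_archClass`** — `∀ 𝒦, 𝒦.IsStd → (∀ a, (a,1) ∈ 𝒦.K ↔ (a,1) ∈ 𝒦₁.K) → hK₀(𝒦)` (RULING «M-160c» (iii)(a), the bytes
  of ★ `isArchDatum_hermiteSpan_of_closure_kV`'s ∕ ★ `K2LiuArchSWSpanningStd.archSWRegionSpanning_std`'s binder `hK₀`), and the converse door
  **`archToAdelic_mem_of_archClass`** (`a ∈ closure → (a,1) ∈ 𝒦.K` on the class: the frame compacts DO lie in `𝒦`).  All hypothesis-first on the reference's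
  law `hsf₁` (the §1 conjunct), so the consumer `obtain`s §1 once and feeds §2 by name.
HONEST LABEL.  Count-neutral helper: `HC_CM` is proved only modulo the 7 printed citations (2 remaining named inputs: hLiu418 = `stmt-HodgeConjecture-24832`,
h413 = `stmt-HodgeConjecture-24833`) until rung 0 closes; this file closes no socket.

## References
* [Weil1964] A. Weil, Acta Math. 111 (1964), Chap. I n° 8 (majorants; maximal compact subgroups of `U(p,q)` as stabilisers of majorants, all conjugate).
* [BorelJacquet1979] A. Borel, H. Jacquet, PSPM 33.1 (1979), §4.1 (`K = K_∞ · K_f`).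
* [PlatonovRapinchuk1994] V. Platonov, A. Rapinchuk, *Algebraic Groups and Number Theory* (1994), §3.2 (conjugacy of maximal compact subgroups).
* [KonnoKonno2007] K. Konno, T. Konno, Kyushu J. Math. 61 (2007), §3.1 (the sign frames `U(P_σ) × U(Q_σ) ⊂ U(P_σ, Q_σ)`).
* [Tan1999] V. Tan, Canad. J. Math. 51 (1999), §1 p. 166 (standard `K` for the doubled unitary group).
-/

set_option autoImplicit false
set_option linter.dupNamespace false -- the mandated namespace repeats `HodgeConjecture.HodgeConjecture`

noncomputable section

open scoped Matrix Classical
open NumberField NumberField.InfinitePlace NumberField.mixedEmbedding IsDedekindDomain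
open Literature.NumberTheory.Automorphic Literature.NumberTheory.Automorphic.UnitaryGroup Literature.NumberTheory.Weil1964
open Literature.NumberTheory.GelbartRogawski1991 Literature.NumberTheory.GelbartRogawski1991.UnitaryDualPair
open Literature.NumberTheory.GelbartRogawski1991.UnitaryDualPair.LocalSplitting
open Literature.NumberTheory.GelbartRogawski1991.GRConstruction Literature.NumberTheory.K2Lit.SiegelDoubled
open Literature.RepresentationTheory.KonnoKonno2007 Literature.RepresentationTheory.KonnoKonno2007.RealDualPair
open Summit.HodgeConjecture.HodgeConjecture.Cruxes.HLiu418 Summit.HodgeConjecture.HodgeConjecture.Cruxes.HLiu418.K2LiuArchSectionPlaceBlock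
open Summit.HodgeConjecture.HodgeConjecture.Cruxes.HLiu418.K2LiuArchTensorPlaceSec
open Summit.HodgeConjecture.HodgeConjecture.Cruxes.HLiu418.K2LiuStdConjDatumFrameCompact (exists_conjDatum_frameCompact)
open Summit.HodgeConjecture.HodgeConjecture.Cruxes.HLiu418.K2LiuIwasawaDatumConjStd (isStd_of_conj)
open Summit.HodgeConjecture.HodgeConjecture.Cruxes.HLiu418.K2LiuIwasawaDatumNonemptyStd (iwasawaDatumNonempty_std)

namespace Summit.HodgeConjecture.HodgeConjecture.Cruxes.HLiu418.K2LiuIwasawaDatumOfRecordSignFrames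

variable (L : Type) [Field L] [NumberField L] [IsCMField L]
variable {N M n : ℕ} (e : Fin N × Fin M ≃ Fin n)
  (dV : Fin N → L) (hdV : ∀ i, IsCMField.complexConj L (dV i) = dV i) (hdV0 : ∀ i, dV i ≠ 0)
  (dW : Fin M → L) (hdW : ∀ i, IsCMField.complexConj L (dW i) = dW i) (hdW0 : ∀ i, dW i ≠ 0)

/-! ## §1 The sign-frame-adapted STANDARD Iwasawa datum -/

/-- **THE SIGN-FRAME-ADAPTED STANDARD IWASAWA DATUM EXISTS.**  There is a STANDARD Iwasawa datum `𝒦₁` of the doubled group `H = U(𝕍 ⊕ −𝕍)` whose archimedean part is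
EXACTLY the sign-frame maximal compact: `(a, 1_f) ∈ 𝒦₁.K ↔ a ∈ Submonoid.closure {placeSec_𝔻 σ (kV k₁) | σ real, k₁ ∈ U(P_σ) × U(Q_σ)}` — the frame-compact conjugate
(★ (R1) `exists_conjDatum_frameCompact`, over ★ B2∕B3: every standard archimedean compact is `g K_diag g⁻¹`) of the tree's standard datum `K₉` (★ J2 `iwasawaDatumNonempty_std`),
standard again by ★ (T) `isStd_of_conj` (conjugator `c⁻¹`, `c = (g, 1_f)`).  [cite: Weil1964, Chap. I n° 8] [cite: PlatonovRapinchuk1994, §3.2] [cite: BorelJacquet1979, §4.1]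
[cite: Tan1999, §1 p. 166] -/
theorem exists_isStd_signFrameAdapted :
    ∃ 𝒦₁ : IwasawaDatum L e dV hdV dW hdW, 𝒦₁.IsStd ∧
      ∀ a : UnitaryGroup.arch (Fp L) L (IsCMField.complexConj L) (n + n) (hermD L e dV hdV dW hdW),
        (UnitaryGroup.archToAdelic (Fp L) L (IsCMField.complexConj L) (n + n) (hermD L e dV hdV dW hdW) a : HA L e dV hdV dW hdW) ∈ 𝒦₁.K ↔
          a ∈ Submonoid.closure {k : UnitaryGroup.arch (Fp L) L (IsCMField.complexConj L) (n + n) (hermD L e dV hdV dW hdW) |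
          ∃ (σ : {v : InfinitePlace (Fp L) // v.IsReal}) (k₁ : Matrix.unitaryGroup (PosIdx (signVec (cmPlaceOver L) (fun k => Sum.elim (cmGramEntry L e dV hdV dW hdW) (-cmGramEntry L e dV hdV dW hdW) ((LocalSplitting.e₂ n).symm k)) (imagUnit L) σ)) ℂ × Matrix.unitaryGroup (NegIdx (signVec (cmPlaceOver L) (fun k => Sum.elim (cmGramEntry L e dV hdV dW hdW) (-cmGramEntry L e dV hdV dW hdW) ((LocalSplitting.e₂ n).symm k)) (imagUnit L) σ)) ℂ),
            k = placeSec L (IsCMField.complexConj L) (n + n) (IsCMField.complexConj_ne_one L) (cmPlaceOver L) (cmPlaceOver_smul L) (fun k => Sum.elim (cmGramEntry L e dV hdV dW hdW) (-cmGramEntry L e dV hdV dW hdW) ((LocalSplitting.e₂ n).symm k))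
            (gramD_gram_realDiagonal_entry_ne_zero L e dV hdV dW hdW hdV0 hdW0) (complexConj_imagUnit L) (imagUnit_ne_zero L) σ
            (cmPlaceOver_comap L) (gramD_eq_diagonal_cm L e dV hdV dW hdW) (J := hermD L e dV hdV dW hdW) rfl
            (complexConj_smul_infinitePlace L) (UForm.kV _ _ k₁)} := by
  obtain ⟨𝒦, h𝒦⟩ := iwasawaDatumNonempty_std L e dV hdV hdV0 dW hdW hdW0
  obtain ⟨-, 𝒦₁, c, -, hlaw, hsf⟩ := exists_conjDatum_frameCompact L e dV hdV hdV0 dW hdW hdW0 h𝒦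
  refine ⟨𝒦₁, isStd_of_conj h𝒦 c⁻¹ fun k => ?_, hsf⟩
  rw [inv_inv]
  exact hlaw k

/-! ## §2 The closure letter `hK₀` at the reference datum and on its arch class -/

/-- **`hK₀(𝒦₁)`**: at a sign-frame-adapted datum (law `hsf₁` of §1) the archimedean part of `𝒦₁.K` lies in the submonoid generated by the frame compacts `placeSec_𝔻 σ (kV k₁)` —
the binder `hK₀` of ★ `K2LiuArchPlaceSecFockDegree.isArchDatum_hermiteSpan_of_closure_kV` ∕ ★ `K2LiuArchSWSpanningStd.archSWRegionSpanning_std` at `𝒦 := 𝒦₁`, byte for byte.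
[cite: KonnoKonno2007, §3.1] [cite: BorelJacquet1979, §4.1] -/
theorem hK₀_of_signFrameAdapted {𝒦₁ : IwasawaDatum L e dV hdV dW hdW}
    (hsf₁ : ∀ a : UnitaryGroup.arch (Fp L) L (IsCMField.complexConj L) (n + n) (hermD L e dV hdV dW hdW),
        (UnitaryGroup.archToAdelic (Fp L) L (IsCMField.complexConj L) (n + n) (hermD L e dV hdV dW hdW) a : HA L e dV hdV dW hdW) ∈ 𝒦₁.K ↔
          a ∈ Submonoid.closure {k : UnitaryGroup.arch (Fp L) L (IsCMField.complexConj L) (n + n) (hermD L e dV hdV dW hdW) |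
          ∃ (σ : {v : InfinitePlace (Fp L) // v.IsReal}) (k₁ : Matrix.unitaryGroup (PosIdx (signVec (cmPlaceOver L) (fun k => Sum.elim (cmGramEntry L e dV hdV dW hdW) (-cmGramEntry L e dV hdV dW hdW) ((LocalSplitting.e₂ n).symm k)) (imagUnit L) σ)) ℂ × Matrix.unitaryGroup (NegIdx (signVec (cmPlaceOver L) (fun k => Sum.elim (cmGramEntry L e dV hdV dW hdW) (-cmGramEntry L e dV hdV dW hdW) ((LocalSplitting.e₂ n).symm k)) (imagUnit L) σ)) ℂ),
            k = placeSec L (IsCMField.complexConj L) (n + n) (IsCMField.complexConj_ne_one L) (cmPlaceOver L) (cmPlaceOver_smul L) (fun k => Sum.elim (cmGramEntry L e dV hdV dW hdW) (-cmGramEntry L e dV hdV dW hdW) ((LocalSplitting.e₂ n).symm k))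
            (gramD_gram_realDiagonal_entry_ne_zero L e dV hdV dW hdW hdV0 hdW0) (complexConj_imagUnit L) (imagUnit_ne_zero L) σ
            (cmPlaceOver_comap L) (gramD_eq_diagonal_cm L e dV hdV dW hdW) (J := hermD L e dV hdV dW hdW) rfl
            (complexConj_smul_infinitePlace L) (UForm.kV _ _ k₁)}) :
    ∀ ainf : UnitaryGroup.arch (Fp L) L (IsCMField.complexConj L) (n + n) (hermD L e dV hdV dW hdW),
      (UnitaryGroup.archToAdelic (Fp L) L (IsCMField.complexConj L) (n + n) (hermD L e dV hdV dW hdW) ainf : HA L e dV hdV dW hdW) ∈ 𝒦₁.K →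
      ainf ∈ Submonoid.closure {k : UnitaryGroup.arch (Fp L) L (IsCMField.complexConj L) (n + n) (hermD L e dV hdV dW hdW) |
        ∃ (σ : {v : InfinitePlace (Fp L) // v.IsReal}) (k₁ : Matrix.unitaryGroup (PosIdx (signVec (cmPlaceOver L) (fun k => Sum.elim (cmGramEntry L e dV hdV dW hdW) (-cmGramEntry L e dV hdV dW hdW) ((LocalSplitting.e₂ n).symm k)) (imagUnit L) σ)) ℂ × Matrix.unitaryGroup (NegIdx (signVec (cmPlaceOver L) (fun k => Sum.elim (cmGramEntry L e dV hdV dW hdW) (-cmGramEntry L e dV hdV dW hdW) ((LocalSplitting.e₂ n).symm k)) (imagUnit L) σ)) ℂ),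
          k = placeSec L (IsCMField.complexConj L) (n + n) (IsCMField.complexConj_ne_one L) (cmPlaceOver L) (cmPlaceOver_smul L) (fun k => Sum.elim (cmGramEntry L e dV hdV dW hdW) (-cmGramEntry L e dV hdV dW hdW) ((LocalSplitting.e₂ n).symm k))
          (gramD_gram_realDiagonal_entry_ne_zero L e dV hdV dW hdW hdV0 hdW0) (complexConj_imagUnit L) (imagUnit_ne_zero L) σ
          (cmPlaceOver_comap L) (gramD_eq_diagonal_cm L e dV hdV dW hdW) (J := hermD L e dV hdV dW hdW) rfl
          (complexConj_smul_infinitePlace L) (UForm.kV _ _ k₁)} :=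
  fun ainf hainf => (hsf₁ ainf).1 hainf

/-- **`hK₀` ON THE ARCH CLASS OF THE REFERENCE (RULING «M-160c» (iii)(a)): `∀ 𝒦, 𝒦.IsStd → (∀ a, (a, 1_f) ∈ 𝒦.K ↔ (a, 1_f) ∈ 𝒦₁.K) → hK₀(𝒦)`.**  For a standard datum `𝒦`
whose archimedean part coincides with that of the sign-frame-adapted reference `𝒦₁` (law `hsf₁` of §1; `hcl` = the inner hypothesis of the (T-F′) transport head, the
shape of ★ `K2LiuStandardSectionSpanArchClassTransport.span_of_archReference`), the closure letter `hK₀(𝒦)` holds — the bytes the (dom)∕(vac) closers (★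
`K2LiuArchSWDataDomainLetters`, via ★ `isArchDatum_hermiteSpan_of_closure_kV … 𝒦 hK₀ D`) and the F4-END `hGgen_of_record` consume.  (`_h𝒦` is carried for the v7 wiring
`hK₀ := hK₀_of_archClass … 𝒦 h𝒦 hcl` only; the implication itself is class-theoretic.) [cite: Weil1964, Chap. I n° 8] [cite: KonnoKonno2007, §3.1] [cite: BorelJacquet1979, §4.1] -/
theorem hK₀_of_archClass {𝒦₁ : IwasawaDatum L e dV hdV dW hdW}
    (hsf₁ : ∀ a : UnitaryGroup.arch (Fp L) L (IsCMField.complexConj L) (n + n) (hermD L e dV hdV dW hdW),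
        (UnitaryGroup.archToAdelic (Fp L) L (IsCMField.complexConj L) (n + n) (hermD L e dV hdV dW hdW) a : HA L e dV hdV dW hdW) ∈ 𝒦₁.K ↔
          a ∈ Submonoid.closure {k : UnitaryGroup.arch (Fp L) L (IsCMField.complexConj L) (n + n) (hermD L e dV hdV dW hdW) |
          ∃ (σ : {v : InfinitePlace (Fp L) // v.IsReal}) (k₁ : Matrix.unitaryGroup (PosIdx (signVec (cmPlaceOver L) (fun k => Sum.elim (cmGramEntry L e dV hdV dW hdW) (-cmGramEntry L e dV hdV dW hdW) ((LocalSplitting.e₂ n).symm k)) (imagUnit L) σ)) ℂ × Matrix.unitaryGroup (NegIdx (signVec (cmPlaceOver L) (fun k => Sum.elim (cmGramEntry L e dV hdV dW hdW) (-cmGramEntry L e dV hdV dW hdW) ((LocalSplitting.e₂ n).symm k)) (imagUnit L) σ)) ℂ),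
            k = placeSec L (IsCMField.complexConj L) (n + n) (IsCMField.complexConj_ne_one L) (cmPlaceOver L) (cmPlaceOver_smul L) (fun k => Sum.elim (cmGramEntry L e dV hdV dW hdW) (-cmGramEntry L e dV hdV dW hdW) ((LocalSplitting.e₂ n).symm k))
            (gramD_gram_realDiagonal_entry_ne_zero L e dV hdV dW hdW hdV0 hdW0) (complexConj_imagUnit L) (imagUnit_ne_zero L) σ
            (cmPlaceOver_comap L) (gramD_eq_diagonal_cm L e dV hdV dW hdW) (J := hermD L e dV hdV dW hdW) rfl
            (complexConj_smul_infinitePlace L) (UForm.kV _ _ k₁)})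
    (𝒦 : IwasawaDatum L e dV hdV dW hdW) (_h𝒦 : 𝒦.IsStd)
    (hcl : ∀ a : UnitaryGroup.arch (Fp L) L (IsCMField.complexConj L) (n + n) (hermD L e dV hdV dW hdW),
        (UnitaryGroup.archToAdelic (Fp L) L (IsCMField.complexConj L) (n + n) (hermD L e dV hdV dW hdW) a : HA L e dV hdV dW hdW) ∈ 𝒦.K ↔
          (UnitaryGroup.archToAdelic (Fp L) L (IsCMField.complexConj L) (n + n) (hermD L e dV hdV dW hdW) a : HA L e dV hdV dW hdW) ∈ 𝒦₁.K) :
    ∀ ainf : UnitaryGroup.arch (Fp L) L (IsCMField.complexConj L) (n + n) (hermD L e dV hdV dW hdW),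
      (UnitaryGroup.archToAdelic (Fp L) L (IsCMField.complexConj L) (n + n) (hermD L e dV hdV dW hdW) ainf : HA L e dV hdV dW hdW) ∈ 𝒦.K →
      ainf ∈ Submonoid.closure {k : UnitaryGroup.arch (Fp L) L (IsCMField.complexConj L) (n + n) (hermD L e dV hdV dW hdW) |
        ∃ (σ : {v : InfinitePlace (Fp L) // v.IsReal}) (k₁ : Matrix.unitaryGroup (PosIdx (signVec (cmPlaceOver L) (fun k => Sum.elim (cmGramEntry L e dV hdV dW hdW) (-cmGramEntry L e dV hdV dW hdW) ((LocalSplitting.e₂ n).symm k)) (imagUnit L) σ)) ℂ × Matrix.unitaryGroup (NegIdx (signVec (cmPlaceOver L) (fun k => Sum.elim (cmGramEntry L e dV hdV dW hdW) (-cmGramEntry L e dV hdV dW hdW) ((LocalSplitting.e₂ n).symm k)) (imagUnit L) σ)) ℂ),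
          k = placeSec L (IsCMField.complexConj L) (n + n) (IsCMField.complexConj_ne_one L) (cmPlaceOver L) (cmPlaceOver_smul L) (fun k => Sum.elim (cmGramEntry L e dV hdV dW hdW) (-cmGramEntry L e dV hdV dW hdW) ((LocalSplitting.e₂ n).symm k))
          (gramD_gram_realDiagonal_entry_ne_zero L e dV hdV dW hdW hdV0 hdW0) (complexConj_imagUnit L) (imagUnit_ne_zero L) σ
          (cmPlaceOver_comap L) (gramD_eq_diagonal_cm L e dV hdV dW hdW) (J := hermD L e dV hdV dW hdW) rfl
          (complexConj_smul_infinitePlace L) (UForm.kV _ _ k₁)} :=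
  fun ainf hainf => (hsf₁ ainf).1 ((hcl ainf).1 hainf)

/-- **THE CONVERSE DOOR ON THE ARCH CLASS**: for `𝒦` in the arch class of the reference `𝒦₁`, every element of the frame-compact submonoid `Submonoid.closure {placeSec_𝔻 σ (kV k₁)}`
lies in `𝒦.K` (so the frame compacts `placeSec_𝔻 σ (kV k₁)` themselves do — the `hk1`-type letters of ★ `K2LiuStdConjDatumFrameCompact.mem_conjDatum_of_kV_range` on the class).
[cite: KonnoKonno2007, §3.1] [cite: BorelJacquet1979, §4.1] -/
theorem archToAdelic_mem_of_archClass {𝒦₁ : IwasawaDatum L e dV hdV dW hdW}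
    (hsf₁ : ∀ a : UnitaryGroup.arch (Fp L) L (IsCMField.complexConj L) (n + n) (hermD L e dV hdV dW hdW),
        (UnitaryGroup.archToAdelic (Fp L) L (IsCMField.complexConj L) (n + n) (hermD L e dV hdV dW hdW) a : HA L e dV hdV dW hdW) ∈ 𝒦₁.K ↔
          a ∈ Submonoid.closure {k : UnitaryGroup.arch (Fp L) L (IsCMField.complexConj L) (n + n) (hermD L e dV hdV dW hdW) |
          ∃ (σ : {v : InfinitePlace (Fp L) // v.IsReal}) (k₁ : Matrix.unitaryGroup (PosIdx (signVec (cmPlaceOver L) (fun k => Sum.elim (cmGramEntry L e dV hdV dW hdW) (-cmGramEntry L e dV hdV dW hdW) ((LocalSplitting.e₂ n).symm k)) (imagUnit L) σ)) ℂ × Matrix.unitaryGroup (NegIdx (signVec (cmPlaceOver L) (fun k => Sum.elim (cmGramEntry L e dV hdV dW hdW) (-cmGramEntry L e dV hdV dW hdW) ((LocalSplitting.e₂ n).symm k)) (imagUnit L) σ)) ℂ),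
            k = placeSec L (IsCMField.complexConj L) (n + n) (IsCMField.complexConj_ne_one L) (cmPlaceOver L) (cmPlaceOver_smul L) (fun k => Sum.elim (cmGramEntry L e dV hdV dW hdW) (-cmGramEntry L e dV hdV dW hdW) ((LocalSplitting.e₂ n).symm k))
            (gramD_gram_realDiagonal_entry_ne_zero L e dV hdV dW hdW hdV0 hdW0) (complexConj_imagUnit L) (imagUnit_ne_zero L) σ
            (cmPlaceOver_comap L) (gramD_eq_diagonal_cm L e dV hdV dW hdW) (J := hermD L e dV hdV dW hdW) rfl
            (complexConj_smul_infinitePlace L) (UForm.kV _ _ k₁)})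
    {𝒦 : IwasawaDatum L e dV hdV dW hdW}
    (hcl : ∀ a : UnitaryGroup.arch (Fp L) L (IsCMField.complexConj L) (n + n) (hermD L e dV hdV dW hdW),
        (UnitaryGroup.archToAdelic (Fp L) L (IsCMField.complexConj L) (n + n) (hermD L e dV hdV dW hdW) a : HA L e dV hdV dW hdW) ∈ 𝒦.K ↔
          (UnitaryGroup.archToAdelic (Fp L) L (IsCMField.complexConj L) (n + n) (hermD L e dV hdV dW hdW) a : HA L e dV hdV dW hdW) ∈ 𝒦₁.K)
    {a : UnitaryGroup.arch (Fp L) L (IsCMField.complexConj L) (n + n) (hermD L e dV hdV dW hdW)}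
    (ha : a ∈ Submonoid.closure {k : UnitaryGroup.arch (Fp L) L (IsCMField.complexConj L) (n + n) (hermD L e dV hdV dW hdW) |
        ∃ (σ : {v : InfinitePlace (Fp L) // v.IsReal}) (k₁ : Matrix.unitaryGroup (PosIdx (signVec (cmPlaceOver L) (fun k => Sum.elim (cmGramEntry L e dV hdV dW hdW) (-cmGramEntry L e dV hdV dW hdW) ((LocalSplitting.e₂ n).symm k)) (imagUnit L) σ)) ℂ × Matrix.unitaryGroup (NegIdx (signVec (cmPlaceOver L) (fun k => Sum.elim (cmGramEntry L e dV hdV dW hdW) (-cmGramEntry L e dV hdV dW hdW) ((LocalSplitting.e₂ n).symm k)) (imagUnit L) σ)) ℂ),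
          k = placeSec L (IsCMField.complexConj L) (n + n) (IsCMField.complexConj_ne_one L) (cmPlaceOver L) (cmPlaceOver_smul L) (fun k => Sum.elim (cmGramEntry L e dV hdV dW hdW) (-cmGramEntry L e dV hdV dW hdW) ((LocalSplitting.e₂ n).symm k))
          (gramD_gram_realDiagonal_entry_ne_zero L e dV hdV dW hdW hdV0 hdW0) (complexConj_imagUnit L) (imagUnit_ne_zero L) σ
          (cmPlaceOver_comap L) (gramD_eq_diagonal_cm L e dV hdV dW hdW) (J := hermD L e dV hdV dW hdW) rfl
          (complexConj_smul_infinitePlace L) (UForm.kV _ _ k₁)}) :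
    (UnitaryGroup.archToAdelic (Fp L) L (IsCMField.complexConj L) (n + n) (hermD L e dV hdV dW hdW) a : HA L e dV hdV dW hdW) ∈ 𝒦.K :=
  (hcl a).2 ((hsf₁ a).2 ha)

end Summit.HodgeConjecture.HodgeConjecture.Cruxes.HLiu418.K2LiuIwasawaDatumOfRecordSignFrames

end
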